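import Summits.ResolutionOfSingularities.ResolutionOfSingularities.Theorems.EquisingularLiftEquisingularLiftNatDepthResidual
import Summits.ResolutionOfSingularities.ResolutionOfSingularities.Theorems.EquisingularLiftEquisingularLiftNatIsoHypPointOfPointsLinAut
import HarnessLib

/-!
# [OURS] THE FIRST CONCRETE LEVEL CERTIFICATE: seat res-D-pv-013's polynomial ONE-STEP datum at a point, in any linear coordinates ⟹ intrinsic depth `0`
# (cruxes `Theses.EquisingularLift.EquisingularLiftNat` / `…NatThree`, stmt-ResolutionOfSingularities-20038 / -20148; every dimension)

[OURS · leafhand-res-equisingularlift-10 g1, 2026-08-31; cell `pub/decomp-res`] AI-produced, weaker than expert review; NOT a statement of any manuscript;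
nothing here proves resolution of singularities in positive characteristic.  DEF-FREE helper; no `sorry`; standard axioms; ZERO named hypotheses.

The depth theorems (✓ p831323 `isoHypPoint_of_towerPoints`, ✓ p831421, ✓ p831468) take «every non-regular point has a `D`-level» for a blow-up tower `D`.
Levels have to be CERTIFIED from equations.  Level `0` (one-step) already has a polynomial certificate in the tree: ✓ `oneStepAt_of_linAut` (p829617) — the
moved equation `F' = linSubst ↑g⁻¹ F` splits at the vertex `P_c` as `Φ + Ψ` (`Φ ≠ 0` the tangent form of degree `μ`, `Ψ ∈ (y)^{μ+1}`) and in each of the `m + 2`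
blow-up charts `y_j ↦ y_l y_j` the strict transform `G` (`Φ + Ψ = y_l^μ G`) is smooth along the exceptional hyperplane `y_l = 0` (Jacobian at every prime).

* ★★ `towerLevel_zero_of_linAut` — **that datum at the point `x` of `V₊(F)` over `P_c` (`x` closed) ⟹ `D 0 V₊(F) x` for EVERY blow-up tower `D`**;
* ★ `towerLevel_zero_of_oneStepAt` — the abstract form: an intrinsic one-step closed point has level `0` (and, by ✓ `tower_mono`, every level).

So the one-step classes of lh10 g0 (cone vertices over smooth `V(Φ)`, ordinary multiple points, `A₁`, the `μ ≥ 2` first-order points of p829888) feed the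
depth theorems at level `0`; level `1` (`A₃ / A₄ / D₄`: one blow-up chart acquires finitely many level-`0` points) is the next certificate to write.
Honest label: closes no registered stub.

References: [Hartshorne1977, II Example 7.1.1, I Thm. 5.1, I Ex. 5.8]; [StacksProject, Tags 080E, 01J5] — through the cited tree files.
-/

set_option linter.dupNamespace false -- mandated namespace `Summit.<Summit>.<Problem>` of this single-conjunct summit

noncomputable section

open CategoryTheory CategoryTheory.Limits AlgebraicGeometry TopologicalSpace
open MvPolynomial HomogeneousLocalization
open Literature.AlgebraicGeometry.Resolution Literature.AlgebraicGeometry.Motives Literature.AlgebraicGeometry.GroupSchemes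
open Literature.AlgebraicGeometry.Motives.SmoothHypersurface Literature.AlgebraicGeometry.Motives.ProjectiveSpace
open AlgebraicGeometry.Scheme.IdealSheafData
open Summit.ResolutionOfSingularities.ResolutionOfSingularities.Cruxes.EquisingularLift.StrataSplit

namespace Summit.ResolutionOfSingularities.ResolutionOfSingularities.Cruxes.EquisingularLiftNat.Sections

/-- ★ **An intrinsic ONE-STEP closed point has level `0`** in every blow-up tower (`hD0`), hence every level `d` (✓ `tower_mono`). [OURS] -/
theorem towerLevel_zero_of_oneStepAt (D : ℕ → ∀ Γ : Scheme.{0}, Γ → Prop)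
    (hD0 : ∀ (Γ : Scheme.{0}) (y : Γ), IsClosed (({y} : Set Γ)) →
      (D 0 Γ y ↔ ∀ (hy : IsClosed (({y} : Set Γ))) (Z : Scheme.{0}) (τ : Z ⟶ Γ), IsBlowup τ (vanishingIdeal ⟨{y}, hy⟩) →
        ∀ z : Z, τ z = y → IsRegularLocalRing (Z.presheaf.stalk z)))
    (hDsucc : ∀ (d : ℕ) (Γ : Scheme.{0}) (y : Γ), IsClosed (({y} : Set Γ)) →
      (D (d + 1) Γ y ↔ ∀ (hy : IsClosed (({y} : Set Γ))) (Z : Scheme.{0}) (τ : Z ⟶ Γ), IsBlowup τ (vanishingIdeal ⟨{y}, hy⟩) →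
        ∃ S' : Finset Z, (∀ z : Z, τ z = y → z ∉ S' → IsRegularLocalRing (Z.presheaf.stalk z)) ∧
          ∀ z ∈ S', τ z = y ∧ IsClosed (({z} : Set Z)) ∧ ∃ d' ≤ d, D d' Z z))
    {Γ : Scheme.{0}} {y : Γ} (hy : IsClosed (({y} : Set Γ)))
    (hone : ∀ (hy' : IsClosed (({y} : Set Γ))) (Z : Scheme.{0}) (τ : Z ⟶ Γ), IsBlowup τ (vanishingIdeal ⟨{y}, hy'⟩) →
        ∀ z : Z, τ z = y → IsRegularLocalRing (Z.presheaf.stalk z)) (d : ℕ) :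
    D d Γ y := by
  induction d with
  | zero => exact (hD0 Γ y hy).mpr hone
  | succ d ih => exact tower_mono D hD0 hDsucc d Γ y hy ih

/-- ★★ **THE POLYNOMIAL ONE-STEP DATUM CERTIFIES INTRINSIC DEPTH `0`.**  `F` a prime form over a field `K`; linear coordinates `(g, c)` in which the moved
equation `F' = linSubst ↑g⁻¹ F` is a prime form of degree `d` carrying the one-step datum `(μ, Φ, Ψ, G_l)` at the vertex `P_c`; `x` the (closed) point of
`V₊(F)` over `P_c`.  Then `D e V₊(F) x` for every blow-up tower `D` and every level `e` (✓ `oneStepAt_of_linAut` + `towerLevel_zero_of_oneStepAt`). [OURS]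
[cite: Hartshorne1977, II Example 7.1.1, I Thm. 5.1] [cite: StacksProject, Tag 080E] -/
theorem towerLevel_zero_of_linAut (K : Type) [Field K] {m : ℕ} (F : MvPolynomial (Fin (m + 2 + 1)) K) {d : ℕ} (hF : F.IsHomogeneous d)
    (hFp : Prime F) (g : GL (Fin (m + 2 + 1)) K) (c : Fin (m + 2 + 1))
    (hF' : (ProjLinAction.linSubst K ((g⁻¹ : GL (Fin (m + 2 + 1)) K) : Matrix (Fin (m + 2 + 1)) (Fin (m + 2 + 1)) K) F).IsHomogeneous d)
    (hF'p : Prime (ProjLinAction.linSubst K ((g⁻¹ : GL (Fin (m + 2 + 1)) K) : Matrix (Fin (m + 2 + 1)) (Fin (m + 2 + 1)) K) F))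
    (hone' : ∃ (μ : ℕ) (Φ Ψ : MvPolynomial (Fin (m + 2)) K), 1 ≤ μ ∧ Φ.IsHomogeneous μ ∧ Φ ≠ 0 ∧
      Ψ ∈ Ideal.span (Set.range (X : Fin (m + 2) → MvPolynomial (Fin (m + 2)) K)) ^ (μ + 1) ∧
      ProjectiveSpace.dehomogenize K c (ProjLinAction.linSubst K ((g⁻¹ : GL (Fin (m + 2 + 1)) K) : Matrix (Fin (m + 2 + 1)) (Fin (m + 2 + 1)) K) F) = Φ + Ψ ∧
      ∀ l : Fin (m + 2), ∃ G : MvPolynomial (Fin (m + 2)) K,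
        aeval (fun j => X l * Function.update (X : Fin (m + 2) → MvPolynomial (Fin (m + 2)) K) l 1 j) (Φ + Ψ) = X l ^ μ * G ∧
        ∀ P : Ideal (MvPolynomial (Fin (m + 2)) K), P.IsPrime → (X l : MvPolynomial (Fin (m + 2)) K) ∈ P → G ∈ P → ∃ j, pderiv j G ∉ P)
    (D : ℕ → ∀ Γ : Scheme.{0}, Γ → Prop)
    (hD0 : ∀ (Γ : Scheme.{0}) (y : Γ), IsClosed (({y} : Set Γ)) →
      (D 0 Γ y ↔ ∀ (hy : IsClosed (({y} : Set Γ))) (Z : Scheme.{0}) (τ : Z ⟶ Γ), IsBlowup τ (vanishingIdeal ⟨{y}, hy⟩) →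
        ∀ z : Z, τ z = y → IsRegularLocalRing (Z.presheaf.stalk z)))
    (hDsucc : ∀ (d : ℕ) (Γ : Scheme.{0}) (y : Γ), IsClosed (({y} : Set Γ)) →
      (D (d + 1) Γ y ↔ ∀ (hy : IsClosed (({y} : Set Γ))) (Z : Scheme.{0}) (τ : Z ⟶ Γ), IsBlowup τ (vanishingIdeal ⟨{y}, hy⟩) →
        ∃ S' : Finset Z, (∀ z : Z, τ z = y → z ∉ S' → IsRegularLocalRing (Z.presheaf.stalk z)) ∧
          ∀ z ∈ S', τ z = y ∧ IsClosed (({z} : Set Z)) ∧ ∃ d' ≤ d, D d' Z z)) :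
    letI := MvPolynomial.gradedAlgebra (σ := Fin (m + 2 + 1)) (R := K)
    ∀ (x : ↥(hypersurface F).left),
      (∀ a : Fin (m + 2 + 1), a ≠ c → ProjLinAction.linSubst K (g : Matrix (Fin (m + 2 + 1)) (Fin (m + 2 + 1)) K) (X a) ∈ ((hypersurfaceι F).left x).asHomogeneousIdeal) →
      IsClosed (({x} : Set ↥(hypersurface F).left)) → ∀ e : ℕ, D e (hypersurface F).left x := by
  letI := MvPolynomial.gradedAlgebra (σ := Fin (m + 2 + 1)) (R := K)
  intro x hxv hx e
  exact towerLevel_zero_of_oneStepAt D hD0 hDsucc hx (oneStepAt_of_linAut K F hF hFp g c hF' hF'p hone' x hxv) e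

end Summit.ResolutionOfSingularities.ResolutionOfSingularities.Cruxes.EquisingularLiftNat.Sections

end
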